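import Summits.Ventures.LatticeQCDFlow.TrivializingMaps.FisherZeroRadiusSharp
import Summits.Ventures.LatticeQCDFlow.TrivializingMaps.FisherZeroNearCoupling

/-!
HONEST FRAMING: exact (Metropolis-corrected) sampling algorithms for lattice gauge theory; figures
of merit are autocorrelation/cost numbers at stated couplings and volumes; no continuum-physics
claim.

# FisherZeroNearCouplingSharp — the nearest Fisher zero to a real coupling `x` is within
# `4 · (half-range of S) / Var_x(S)`; for the Wilson action within `4n / (specific heat per
# plaquette at x)` (lean-2 GEN-7, ours)

Venture-side (OURS).  Cell `lqcd-flow` (pub-lqcd), unit `pub-lqcd-lean-2-g7`, 2026-08-22.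

`FisherZeroNearCoupling` (GEN-6) located a zero of `Z(s) = ∫ D[U] e^{-sS}` within `R` of the real
coupling `x` under `Var_x(S∘ι) > 128(|b|R + 1)/R²` (`|S∘ι| ≤ b`, variance in the ensemble
`𝒵⁻¹e^{-xS}D[U]`).  With the sharp inequality of `FisherZeroRadiusSharp` (coefficient form of
Borel–Carathéodory) the statement becomes a clean law with no free parameter:

* **`exists_zero_near_norm_le_of_variance_tilted_pos`** (probability): `|X − c| ≤ b` a.e.,
  `Var_{μ.tilted(xX)}(X) > 0` `⇒` `∫ e^{zX} dμ = 0` for some `|z − x| ≤ 4|b| / Var_{μ.tilted(xX)}(X)`;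
  strict form `exists_zero_near_norm_lt_of_lt_variance_tilted` (`4|b|/R < Var ⇒ |z − x| < R`).
* **`exists_actionZ_eq_zero_near_norm_le`**, **`infDist_actionZ_zeroSet_le`** (docked): for every
  smooth action with `|S∘ι − c| ≤ b` and every real `x` with `Var_x(S∘ι) > 0`,
  **`dist(x, F_Z) ≤ 4|b| / Var_x(S∘ι)`** — the specific heat at `x` bounds the distance to the
  nearest Fisher zero; `Staircase.step_le_of_variance_pos`: every staircase stage centred at `x`
  and summable at `x + Δ/(1-η)` has `Δ ≤ (1-η)·4|b|/Var_x(S∘ι)` (THEOREM S made observable, sharp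
  constant).
* **`wilson_infDist_zeroSet_le`** (Wilson action, centre and half-range `n·#plaq`): for every `d`,
  `L`, `n` and every real coupling `x` with `Var_{wilsonMeasure ρ₀ x}(S_W) > 0`,
  `dist(x, F_{Z_L}) ≤ 4n·#plaq / Var_x(S_W)` `= 4n / c_L(x)`, `c_L(x)` the specific heat per
  plaquette; `wilson_exists_fisherZero_near_norm_le` the zero itself.

NOT CLAIMED: any value of `Var_x(S_W)` at any `x ≠ 0` (at `x = 0` it is `m₂(n)·#plaq`,
`WilsonVarianceExtensive`, giving back `FisherZeroRadiusSharp`); sharpness of the constant `4`;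
cost / autocorrelation / continuum statements.
-/

open MeasureTheory ProbabilityTheory Filter Topology Complex Set Metric
open Literature.MathematicalPhysics.QuantumFieldTheory
open Literature.MathematicalPhysics.QuantumFieldTheory.Luscher2010
open Literature.MathematicalPhysics.QuantumFieldTheory.WilsonFlow (coeConfig continuous_coeConfig)
open scoped Matrix Matrix.Norms.Frobenius ContDiff

namespace Summit.Ventures.LatticeQCDFlow.TrivializingMaps

/-! ## §1 Probability: a zero within `4·(half-range)/Var` of the tilting parameter -/

section General

variable {Ω : Type*} [MeasurableSpace Ω] {μ : Measure Ω} [IsProbabilityMeasure μ]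
  {X : Ω → ℝ} {b c : ℝ}

/-- **Strict form.**  `|X − c| ≤ b` a.e. and `4|b|/R < Var_{μ.tilted(xX)}(X)` (`R > 0`) `⇒`
`∫ e^{zX} dμ = 0` for some `|z − x| < R`. [ours] -/
theorem exists_zero_near_norm_lt_of_lt_variance_tilted (hm : AEMeasurable X μ)
    (hb : ∀ᵐ u ∂μ, |X u - c| ≤ b) (x : ℝ) {R : ℝ} (hR : 0 < R)
    (hvar : 4 * |b| / R < variance X (μ.tilted fun y => x * X y)) :
    ∃ z : ℂ, ‖z - x‖ < R ∧ complexMGF X μ z = 0 := by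
  have hb0 : ∀ᵐ u ∂μ, |X u| ≤ |c| + b := hb.mono fun u hu => by
    calc |X u| = |(X u - c) + c| := by rw [sub_add_cancel]
      _ ≤ |X u - c| + |c| := abs_add_le _ _
      _ ≤ |c| + b := by linarith
  have hint : Integrable (fun y => Real.exp (x * X y)) μ :=
    integrable_exp_mul_of_mem_Icc hm (hb0.mono fun _ h => mem_Icc.2 (abs_le.1 h))
  haveI : IsProbabilityMeasure (μ.tilted fun y => x * X y) := isProbabilityMeasure_tilted hint
  have hm' : AEMeasurable X (μ.tilted fun y => x * X y) :=
    hm.mono_ac (tilted_absolutelyContinuous _ _)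
  have hb' : ∀ᵐ u ∂(μ.tilted fun y => x * X y), |X u - c| ≤ b :=
    (tilted_absolutelyContinuous _ _).ae_le hb
  obtain ⟨u, hu, hZ⟩ := exists_zero_norm_lt_of_lt_variance hm' hb' hR hvar
  refine ⟨x + u, by simpa using hu, ?_⟩
  rw [complexMGF_tilted_mul] at hZ
  rcases div_eq_zero_iff.mp hZ with h | h
  · exact h
  · exact absurd (by exact_mod_cast h : mgf X μ x = 0) (mgf_pos hint).ne'

/-- **Closed form: a zero within `4·(half-range)/Var` of `x`.**  `|X − c| ≤ b` a.e. and
`Var_{μ.tilted(xX)}(X) > 0` `⇒` `∫ e^{zX} dμ = 0` for some `|z − x| ≤ 4|b| / Var_{μ.tilted(xX)}(X)`.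
[ours] -/
theorem exists_zero_near_norm_le_of_variance_tilted_pos (hm : AEMeasurable X μ)
    (hb : ∀ᵐ u ∂μ, |X u - c| ≤ b) (x : ℝ)
    (hvar : 0 < variance X (μ.tilted fun y => x * X y)) :
    ∃ z : ℂ, ‖z - x‖ ≤ 4 * |b| / variance X (μ.tilted fun y => x * X y) ∧
      complexMGF X μ z = 0 := by
  have hb0 : ∀ᵐ u ∂μ, |X u| ≤ |c| + b := hb.mono fun u hu => by
    calc |X u| = |(X u - c) + c| := by rw [sub_add_cancel]
      _ ≤ |X u - c| + |c| := abs_add_le _ _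
      _ ≤ |c| + b := by linarith
  have hint : Integrable (fun y => Real.exp (x * X y)) μ :=
    integrable_exp_mul_of_mem_Icc hm (hb0.mono fun _ h => mem_Icc.2 (abs_le.1 h))
  haveI : IsProbabilityMeasure (μ.tilted fun y => x * X y) := isProbabilityMeasure_tilted hint
  have hm' : AEMeasurable X (μ.tilted fun y => x * X y) :=
    hm.mono_ac (tilted_absolutelyContinuous _ _)
  have hb' : ∀ᵐ u ∂(μ.tilted fun y => x * X y), |X u - c| ≤ b :=
    (tilted_absolutelyContinuous _ _).ae_le hb
  obtain ⟨u, hu, hZ⟩ := exists_zero_norm_le_of_variance_pos hm' hb' hvar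
  refine ⟨x + u, by simpa using hu, ?_⟩
  rw [complexMGF_tilted_mul] at hZ
  rcases div_eq_zero_iff.mp hZ with h | h
  · exact h
  · exact absurd (by exact_mod_cast h : mgf X μ x = 0) (mgf_pos hint).ne'

end General

/-! ## §2 Docked: `dist(x, F_Z) ≤ 4·(half-range)/Var_x(S)` -/

section ActionZ

variable {d L n : ℕ} [NeZero L] {S : AmbConfig d L n → ℝ}

/-- **A Fisher zero within `4|b|/Var_x(S∘ι)` of the real coupling `x`** (smooth action,
`|S∘ι − c| ≤ b`, variance in the ensemble `𝒵⁻¹e^{-xS}D[U]`, assumed positive). [ours] -/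
theorem exists_actionZ_eq_zero_near_norm_le (hS : ContDiff ℝ ∞ S) {c b : ℝ}
    (hb : ∀ U : GaugeConfig d L (Matrix.specialUnitaryGroup (Fin n) ℂ), |S (coeConfig U) - c| ≤ b)
    (x : ℝ)
    (hvar : 0 < variance (fun U => S (coeConfig U))
      (boltzmannMeasure fun U : GaugeConfig d L (Matrix.specialUnitaryGroup (Fin n) ℂ) =>
        x * S (coeConfig U))) :
    ∃ s₀ : ℂ, ‖s₀ - x‖ ≤ 4 * |b| / variance (fun U => S (coeConfig U))
        (boltzmannMeasure fun U : GaugeConfig d L (Matrix.specialUnitaryGroup (Fin n) ℂ) =>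
          x * S (coeConfig U)) ∧
      complexMGF (fun U => -S (coeConfig U))
        (trivialMeasure (Matrix.specialUnitaryGroup (Fin n) ℂ) d L) s₀ = 0 := by
  have hm : AEMeasurable (fun U => -S (coeConfig U))
      (trivialMeasure (Matrix.specialUnitaryGroup (Fin n) ℂ) d L) :=
    (integrable_trivialMeasure_of_continuous (continuous_comp_coeConfig hS).neg).aemeasurable
  have hb' : ∀ᵐ U ∂(trivialMeasure (Matrix.specialUnitaryGroup (Fin n) ℂ) d L),
      |(-S (coeConfig U)) - (-c)| ≤ b := ae_of_all _ fun U => by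
    rw [show -S (coeConfig U) - -c = -(S (coeConfig U) - c) by ring, abs_neg]
    exact hb U
  have hveq : variance (fun U => -S (coeConfig U))
      ((trivialMeasure (Matrix.specialUnitaryGroup (Fin n) ℂ) d L).tilted
        fun U => x * (-S (coeConfig U))) =
      variance (fun U => S (coeConfig U))
        (boltzmannMeasure fun U : GaugeConfig d L (Matrix.specialUnitaryGroup (Fin n) ℂ) =>
          x * S (coeConfig U)) := by
    rw [variance_fun_neg, ← boltzmannMeasure_smul_eq_tilted hS x]
  have hvar' : 0 < variance (fun U => -S (coeConfig U))
      ((trivialMeasure (Matrix.specialUnitaryGroup (Fin n) ℂ) d L).tilted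
        fun U => x * (-S (coeConfig U))) := by rw [hveq]; exact hvar
  obtain ⟨s₀, hs₀, hz⟩ := exists_zero_near_norm_le_of_variance_tilted_pos hm hb' x hvar'
  exact ⟨s₀, by rwa [hveq] at hs₀, hz⟩

/-- **`dist(x, F_Z) ≤ 4|b| / Var_x(S∘ι)`**: the distance from a real coupling to the Fisher zero set is
bounded by four half-ranges of the action over its variance at that coupling. [ours] -/
theorem infDist_actionZ_zeroSet_le (hS : ContDiff ℝ ∞ S) {c b : ℝ}
    (hb : ∀ U : GaugeConfig d L (Matrix.specialUnitaryGroup (Fin n) ℂ), |S (coeConfig U) - c| ≤ b)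
    (x : ℝ)
    (hvar : 0 < variance (fun U => S (coeConfig U))
      (boltzmannMeasure fun U : GaugeConfig d L (Matrix.specialUnitaryGroup (Fin n) ℂ) =>
        x * S (coeConfig U))) :
    infDist (x : ℂ) {s : ℂ | complexMGF (fun U => -S (coeConfig U))
      (trivialMeasure (Matrix.specialUnitaryGroup (Fin n) ℂ) d L) s = 0} ≤
      4 * |b| / variance (fun U => S (coeConfig U))
        (boltzmannMeasure fun U : GaugeConfig d L (Matrix.specialUnitaryGroup (Fin n) ℂ) =>
          x * S (coeConfig U)) := by
  obtain ⟨s₀, hs₀, hz⟩ := exists_actionZ_eq_zero_near_norm_le hS hb x hvar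
  refine (infDist_le_dist_of_mem (by exact hz)).trans ?_
  rwa [dist_comm, dist_eq_norm]

/-- **THE SPECIFIC HEAT CAPS THE STAGE** (THEOREM S made observable, sharp constant): every
staircase stage centred at the real coupling `x` and summable at `x + Δ/(1-η)` (`Δ ≥ 0`, `η < 1`)
has `Δ ≤ (1-η) · 4|b| / Var_x(S∘ι)`. [ours] -/
theorem Staircase.step_le_of_variance_pos (hS : ContDiff ℝ ∞ S) {c b : ℝ}
    (hb : ∀ U : GaugeConfig d L (Matrix.specialUnitaryGroup (Fin n) ℂ), |S (coeConfig U) - c| ≤ b)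
    {x Δ η : ℝ} (hΔ : 0 ≤ Δ) (hη : η < 1)
    (hvar : 0 < variance (fun U => S (coeConfig U))
      (boltzmannMeasure fun U : GaugeConfig d L (Matrix.specialUnitaryGroup (Fin n) ℂ) =>
        x * S (coeConfig U)))
    (hsum : Summable fun k : ℕ => (k.factorial : ℂ)⁻¹ *
      iteratedDeriv k (fun w => deriv (complexMGF (fun U => -S (coeConfig U))
          (trivialMeasure (Matrix.specialUnitaryGroup (Fin n) ℂ) d L)) w /
        complexMGF (fun U => -S (coeConfig U))
          (trivialMeasure (Matrix.specialUnitaryGroup (Fin n) ℂ) d L) w) x *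
      (((x + Δ / (1 - η) : ℝ) : ℂ) - x) ^ k) :
    Δ ≤ (1 - η) * (4 * |b| / variance (fun U => S (coeConfig U))
      (boltzmannMeasure fun U : GaugeConfig d L (Matrix.specialUnitaryGroup (Fin n) ℂ) =>
        x * S (coeConfig U))) := by
  obtain ⟨s₀, hs₀, hz⟩ := exists_actionZ_eq_zero_near_norm_le hS hb x hvar
  have h := Staircase.step_le_of_stage_summable (d := d) (L := L) (n := n) hS hΔ hη hsum hz
  have h1η : 0 < 1 - η := sub_pos.mpr hη
  calc Δ ≤ (1 - η) * ‖(x : ℂ) - s₀‖ := h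
    _ ≤ (1 - η) * (4 * |b| / _) := by
        refine mul_le_mul_of_nonneg_left ?_ h1η.le
        rwa [norm_sub_rev]

end ActionZ

/-! ## §3 Wilson action: `dist(x, F_{Z_L}) ≤ 4n·#plaq / Var_x(S_W)` -/

section Wilson

variable {d L n : ℕ} [NeZero L]

/-- **A Fisher zero of `Z_L` within `4n·#plaq / Var_x(S_W)` of the real coupling `x`** (variance of
the Wilson action under `wilsonMeasure ρ₀ x`, assumed positive; every `d`, `L`, `n`). [ours] -/
theorem wilson_exists_fisherZero_near_norm_le (x : ℝ)
    (hvar : 0 < variance (wilsonAction (StrongCoupling.defRep n))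
        (wilsonMeasure (d := d) (L := L) (StrongCoupling.defRep n) x)) :
    ∃ s₀ : ℂ, ‖s₀ - x‖ ≤ 4 * (n * Fintype.card (Plaquette d L)) /
        variance (wilsonAction (StrongCoupling.defRep n))
          (wilsonMeasure (d := d) (L := L) (StrongCoupling.defRep n) x) ∧
      complexMGF (fun U => -ambWilsonAction (coeConfig U))
        (trivialMeasure (Matrix.specialUnitaryGroup (Fin n) ℂ) d L) s₀ = 0 := by
  have hV : variance (fun U => ambWilsonAction (coeConfig U))
      (boltzmannMeasure fun U : GaugeConfig d L (Matrix.specialUnitaryGroup (Fin n) ℂ) =>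
        x * ambWilsonAction (coeConfig U)) =
      variance (wilsonAction (StrongCoupling.defRep n))
        (wilsonMeasure (d := d) (L := L) (StrongCoupling.defRep n) x) := by
    rw [StrongCoupling.boltzmannMeasure_smul_ambWilsonAction x]
    simp_rw [StrongCoupling.ambWilsonAction_coeConfig]
  have hvar' : 0 < variance (fun U => ambWilsonAction (coeConfig U))
      (boltzmannMeasure fun U : GaugeConfig d L (Matrix.specialUnitaryGroup (Fin n) ℂ) =>
        x * ambWilsonAction (coeConfig U)) := by rw [hV]; exact hvar
  obtain ⟨s₀, hs₀, hz⟩ := exists_actionZ_eq_zero_near_norm_le (d := d) (L := L) (n := n)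
    contDiff_ambWilsonAction (c := n * Fintype.card (Plaquette d L))
    (b := n * Fintype.card (Plaquette d L)) abs_ambWilsonAction_sub_le x hvar'
  refine ⟨s₀, ?_, hz⟩
  rwa [hV, abs_of_nonneg (by positivity)] at hs₀

/-- **`dist(x, F_{Z_L}) ≤ 4n·#plaq / Var_x(S_W)`** — four times `n` over the specific heat per
plaquette at coupling `x`. [ours] -/
theorem wilson_infDist_zeroSet_le (x : ℝ)
    (hvar : 0 < variance (wilsonAction (StrongCoupling.defRep n))
        (wilsonMeasure (d := d) (L := L) (StrongCoupling.defRep n) x)) :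
    infDist (x : ℂ) {s : ℂ | complexMGF (fun U => -ambWilsonAction (coeConfig U))
      (trivialMeasure (Matrix.specialUnitaryGroup (Fin n) ℂ) d L) s = 0} ≤
      4 * (n * Fintype.card (Plaquette d L)) /
        variance (wilsonAction (StrongCoupling.defRep n))
          (wilsonMeasure (d := d) (L := L) (StrongCoupling.defRep n) x) := by
  obtain ⟨s₀, hs₀, hz⟩ := wilson_exists_fisherZero_near_norm_le (d := d) (L := L) (n := n) x hvar
  refine (infDist_le_dist_of_mem (by exact hz)).trans ?_
  rwa [dist_comm, dist_eq_norm]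

end Wilson

end Summit.Ventures.LatticeQCDFlow.TrivializingMaps
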